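import Summits.NavierStokesRegularity.FluidComputer.AbcCrayaAssembly
import Summits.NavierStokesRegularity.FluidComputer.CrayaReality
import Summits.NavierStokesRegularity.FluidComputer.AbcClassIIBasis
import Summits.NavierStokesRegularity.FluidComputer.AbcLatticeTailCoercivity

/-!
# The certifier's Craya matrix ↔ the Cartesian / class-II pairing: one object in two coordinate
# systems, and its REALITY on conjugate-symmetric families ((F4) in Craya coordinates)
(instab3 g6 — implementation 1 of the skew-cut X0 certifier, cell `ns-blowup`, 2026-08-27)

HONEST FRAMING (human rulings D-0035/D-0074): nothing here is a claim about Navier–Stokes blow-up.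
WHAT THIS IS NOT: not NS evidence; MODEL lane; no certificate, printed number or census word is
used or moved. TRIGGER-CENSUS T6 residue (r50) «the class-II Craya ↔ Cartesian change of coordinates
of the certificate matrices»: implementation 1 (i3, INSTAB3-METHOD §2/§4) assembles the first-order
part as the CRAYA matrix `A = abcCrayaMatrix A B C` on `CrayaIdx` (`AbcCrayaMatrix`, instab3 g5) and
compresses it to a real orthonormal class-II basis, `T[p,q] = Σ_i conj(c_p i) (A c_q)_i`;
implementation 2 (instab4 g6, `AbcClassIIDefs`) writes the same first-order part on CARTESIAN families
as `Π_k (crossForm A B C c k)` and its real class-II matrix as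
`amat i j = Re Σ_k ⟪bfam i k, Π_k crossForm 1 1 1 (bfam j) k⟫` in an existential orbit-adapted basis.
This file identifies the two, family by family:

* §15 `sum_conj_mul_abcCrayaMatrix_eq₂`: the BILINEAR pairing in Craya coordinates is the Cartesian
  pairing, `Σ_{i∈S} conj(u_i) (A v)_i = Σ_{k ∈ freq(S)} ⟪c_u(k), crossForm A B C c_v k⟫`
  (`c = crayaSynth`; g5's `sum_conj_mul_abcCrayaMatrix_eq` was the case `u = v`);
* §16 REALITY: if `c_u`, `c_v` are conjugate-symmetric (real vector fields;
  `CrayaReality.isConjSymm_crayaSynth_iff` is the coordinate criterion) then `Σ_i conj(u_i)(A v)_i` is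
  REAL (`conj_sum_conj_mul_abcCrayaMatrix`, `im_sum_conj_mul_abcCrayaMatrix_eq_zero`) — the certifier's
  «imaginary balls all contain 0» (INSTAB3-METHOD §4) / «A_R real» (§2 self-test) as a theorem, and the
  entrywise reality `har` that `SkewCutGalerkinRealShell` asks of the first-order matrix in a J-real
  basis (`exists_real_entries`);
* §17 BRIDGE to Cartesian families: for transversal mean-free families `f`, `g` with `f` supported in a
  finite frequency set `Q ∌ 0`,
  `Σ_{k∈Q} ⟪f k, Π_k crossForm A B C g k⟫ = Σ_{p over Q} conj(crayaCoord f p) (A crayaCoord g)_p`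
  (`sum_inner_leray_crossForm_eq_craya`; the Leray multiplier is invisible against transversal `f`),
  and hence instab4's class-II matrix IS the certifier's Craya compression of its basis:
  `amat i j = Re Σ_p conj(crayaCoord (bfam i) p) (abcCrayaMatrix 1 1 1 · crayaCoord (bfam j))_p`
  (`amat_eq_re_craya`).

Mathlib + tree files only (instab4 g5/g6 `AbcLatticeReality`, `AbcClassIIBasis`,
`AbcLatticeTailCoercivity.inner_lerayCoeff_eq`); no definitions.
-/

noncomputable section

open scoped BigOperators InnerProductSpace ComplexConjugate Matrix
open Finset

namespace Summit.NavierStokesRegularity.FluidComputer.AbcCrayaClassIIBridge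

open Literature.Analysis.FluidPDE Literature.Analysis.FluidPDE.SteadyLattice
open Literature.Analysis.FunctionSpaces Literature.Analysis.FunctionSpaces.Torus
open Literature.Analysis.FunctionSpaces.EuclideanSpace
open Summit.NavierStokesRegularity.FluidComputer.CrayaFrames
open Summit.NavierStokesRegularity.FluidComputer.AbcCrayaMatrix
open Summit.NavierStokesRegularity.FluidComputer.AbcCrayaAssembly

/-! ### §15 The bilinear pairing in Craya coordinates is the Cartesian pairing -/

/-- instab4's `crossForm` written as a sum over the six shell labels `(j, ±)` (the form in which
`AbcCrayaMatrix.sum_abcCrayaMatrix_mul_eq_inner` states the row action). -/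
theorem crossForm_eq_sum_dir (A B C : ℝ) (c : (Fin 3 → ℤ) → EuclideanSpace ℂ (Fin 3)) (k : Fin 3 → ℤ) :
    AbcClassII.crossForm A B C c k = ∑ y : Fin 3 × Bool,
      WithLp.toLp 2 (WithLp.ofLp (Torus.abcCoeff A B C (Torus.abcDir y)) ⨯₃
        (Complex.I • ((fun m : Fin 3 => (((k - Torus.abcDir y) m : ℤ) : ℂ)) ⨯₃
          WithLp.ofLp (c (k - Torus.abcDir y))) - WithLp.ofLp (c (k - Torus.abcDir y)))) := by
  rw [AbcClassII.crossForm, Torus.sum_abcFreq]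

/-- **The bilinear pairing of the certifier's matrix in Craya coordinates IS the Cartesian pairing.**
For coordinate families `u` (supported in a finite `S`) and `v`:
`∑_{i ∈ S} conj(u_i) ∑_{j ∈ band(i)} A_ij v_j = ∑_{k ∈ freq(S)} ⟪c_u(k), X c_v(k)⟫`,
`c = crayaSynth`, `X = AbcClassII.crossForm A B C` (instab4's Cartesian first-order symbol).
(g5's `sum_conj_mul_abcCrayaMatrix_eq` is the diagonal case `u = v`.) -/
theorem sum_conj_mul_abcCrayaMatrix_eq₂ (A B C : ℝ) (u v : CrayaIdx → ℂ) (S : Finset CrayaIdx)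
    (huS : ∀ i ∉ S, u i = 0) :
    ∑ i ∈ S, conj (u i) * ∑ j ∈ crayaNbr i, abcCrayaMatrix A B C i j * v j =
      ∑ k ∈ (S.image fun i => i.1.1),
        ⟪crayaSynth u k, AbcClassII.crossForm A B C (crayaSynth v) k⟫_ℂ := by
  classical
  rw [sum_support_eq_sum_image u S huS
    (fun i z => conj z * ∑ j ∈ crayaNbr i, abcCrayaMatrix A B C i j * v j) (fun i => by simp)]
  refine Finset.sum_congr rfl fun k _ => ?_
  by_cases hk : k = 0
  · subst hk; simp [crayaSynth_zero_freq]
  · simp only [hk, dif_neg, not_false_eq_true]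
    rw [inner_crayaSynth_left u hk, crossForm_eq_sum_dir]
    refine Finset.sum_congr rfl fun a _ => ?_
    rw [sum_abcCrayaMatrix_mul_eq_inner]

/-! ### §16 REALITY on conjugate-symmetric (real-field) families -/

/-- **REALITY of the compressed entries ((F4) in Craya coordinates).** If the synthesised families
`c_u`, `c_v` are conjugate-symmetric (`c(−k) = conj c(k)`: coefficient families of REAL vector
fields; coordinate criterion `CrayaReality.isConjSymm_crayaSynth_iff`) and `u` is finitely supported,
then the pairing `∑_i conj(u_i) (A v)_i` of the certifier's matrix is invariant under conjugation —
because `X` commutes with `J` (`AbcLatticeReality.isConjSymm_crossForm`, instab4 g5) and the pairing of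
two conjugate-symmetric families over a `±`-symmetric frequency set is real
(`AbcClassII.conj_sum_inner_of_isConjSymm`, instab4 g6). This is INSTAB3-METHOD §4 «the exact value is
real (J-symmetry): imaginary balls all contain 0» and §2 self-test «A_R real» as a theorem: the
certifier's matrix `T = Bᵀ W̄ A_C Wᵀ B` is real in ANY J-real orthonormal basis. -/
theorem conj_sum_conj_mul_abcCrayaMatrix (A B C : ℝ) (u v : CrayaIdx → ℂ) (S : Finset CrayaIdx)
    (huS : ∀ i ∉ S, u i = 0) (hu : IsConjSymm (crayaSynth u)) (hv : IsConjSymm (crayaSynth v)) :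
    conj (∑ i ∈ S, conj (u i) * ∑ j ∈ crayaNbr i, abcCrayaMatrix A B C i j * v j) =
      ∑ i ∈ S, conj (u i) * ∑ j ∈ crayaNbr i, abcCrayaMatrix A B C i j * v j := by
  classical
  -- pass to the Cartesian pairing over the symmetrised frequency set `Q ∪ (−Q)`
  set Q : Finset (Fin 3 → ℤ) := S.image fun i => i.1.1 with hQ
  set Q' : Finset (Fin 3 → ℤ) := Q ∪ Q.image (fun k => -k) with hQ'
  have hQQ' : Q ⊆ Q' := Finset.subset_union_left
  have hsymm : ∀ k ∈ Q', -k ∈ Q' := by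
    intro k hk
    rcases Finset.mem_union.mp hk with h | h
    · exact Finset.mem_union.mpr (Or.inr (Finset.mem_image.mpr ⟨k, h, rfl⟩))
    · obtain ⟨m, hm, rfl⟩ := Finset.mem_image.mp h
      rw [neg_neg]; exact hQQ' hm
  have hX : IsConjSymm (fun k => AbcClassII.crossForm A B C (crayaSynth v) k) :=
    AbcLatticeReality.isConjSymm_crossForm A B C hv
  have hext : ∑ k ∈ Q, ⟪crayaSynth u k, AbcClassII.crossForm A B C (crayaSynth v) k⟫_ℂ =
      ∑ k ∈ Q', ⟪crayaSynth u k, AbcClassII.crossForm A B C (crayaSynth v) k⟫_ℂ :=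
    Finset.sum_subset hQQ' fun k _ hk => by
      rw [crayaSynth_eq_zero_of_not_mem_image u S huS hk, inner_zero_left]
  rw [sum_conj_mul_abcCrayaMatrix_eq₂ A B C u v S huS, hext]
  exact AbcClassII.conj_sum_inner_of_isConjSymm hu hX hsymm

/-- **The compressed entries have zero imaginary part** on conjugate-symmetric families. -/
theorem im_sum_conj_mul_abcCrayaMatrix_eq_zero (A B C : ℝ) (u v : CrayaIdx → ℂ) (S : Finset CrayaIdx)
    (huS : ∀ i ∉ S, u i = 0) (hu : IsConjSymm (crayaSynth u)) (hv : IsConjSymm (crayaSynth v)) :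
    (∑ i ∈ S, conj (u i) * ∑ j ∈ crayaNbr i, abcCrayaMatrix A B C i j * v j).im = 0 :=
  Complex.conj_eq_iff_im.mp (conj_sum_conj_mul_abcCrayaMatrix A B C u v S huS hu hv)

/-- **The compressed entry is the real number `Re(·)`**: `∑_i conj(u_i)(A v)_i = ↑(Re ∑_i conj(u_i)(A v)_i)`
on conjugate-symmetric families. -/
theorem sum_conj_mul_abcCrayaMatrix_eq_ofReal_re (A B C : ℝ) (u v : CrayaIdx → ℂ) (S : Finset CrayaIdx)
    (huS : ∀ i ∉ S, u i = 0) (hu : IsConjSymm (crayaSynth u)) (hv : IsConjSymm (crayaSynth v)) :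
    ∑ i ∈ S, conj (u i) * ∑ j ∈ crayaNbr i, abcCrayaMatrix A B C i j * v j =
      (((∑ i ∈ S, conj (u i) * ∑ j ∈ crayaNbr i, abcCrayaMatrix A B C i j * v j).re : ℝ) : ℂ) :=
  (Complex.conj_eq_iff_re.mp (conj_sum_conj_mul_abcCrayaMatrix A B C u v S huS hu hv)).symm

/-- **Entrywise reality of the compressed first-order matrix in a J-real coordinate basis** (the
`har` datum of `SkewCutGalerkinRealShell`): for a family `(c_p)` of finitely supported Craya
coordinate vectors with conjugate-symmetric syntheses, the matrix
`a_pq = ∑_i conj(c_p i) (A c_q)_i` equals the real matrix `(Re a_pq)`. -/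
theorem exists_real_entries {P : Type*} (A B C : ℝ) (cb : P → CrayaIdx → ℂ) (supp : P → Finset CrayaIdx)
    (hsupp : ∀ p, ∀ i ∉ supp p, cb p i = 0) (hJ : ∀ p, IsConjSymm (crayaSynth (cb p))) :
    ∃ ar : P → P → ℝ, ∀ p q,
      ∑ i ∈ supp p, conj (cb p i) * ∑ j ∈ crayaNbr i, abcCrayaMatrix A B C i j * cb q j = (ar p q : ℂ) :=
  ⟨fun p q => (∑ i ∈ supp p, conj (cb p i) * ∑ j ∈ crayaNbr i, abcCrayaMatrix A B C i j * cb q j).re,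
    fun p q => sum_conj_mul_abcCrayaMatrix_eq_ofReal_re A B C (cb p) (cb q) (supp p) (hsupp p) (hJ p) (hJ q)⟩

/-! ### §17 BRIDGE to Cartesian families and to implementation 2's class-II matrix `amat` -/

/-- The Craya coordinates of a family vanishing off `Q` vanish off the indices over `Q`. -/
theorem crayaCoord_eq_zero_of_not_mem {f : (Fin 3 → ℤ) → EuclideanSpace ℂ (Fin 3)}
    {Q : Finset (Fin 3 → ℤ)} (hfQ : ∀ k ∉ Q, f k = 0) {p : CrayaIdx}
    (hp : p ∉ (Q.subtype fun k => k ≠ 0) ×ˢ (Finset.univ : Finset (Fin 2))) : crayaCoord f p = 0 := by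
  have hk : p.1.1 ∉ Q := by
    intro h
    exact hp (Finset.mem_product.mpr ⟨Finset.mem_subtype.mpr h, Finset.mem_univ _⟩)
  rw [crayaCoord, hfQ _ hk, inner_zero_right]

/-- The frequency image of the indices over `Q` is `Q` without the origin. -/
theorem image_fst_indices_over (Q : Finset (Fin 3 → ℤ)) :
    (((Q.subtype fun k => k ≠ 0) ×ˢ (Finset.univ : Finset (Fin 2))).image fun i : CrayaIdx => i.1.1) =
      Q.filter fun k => k ≠ 0 := by
  ext k
  simp only [Finset.mem_image, Finset.mem_product, Finset.mem_subtype, Finset.mem_univ, and_true,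
    Finset.mem_filter]
  constructor
  · rintro ⟨i, hi, rfl⟩; exact ⟨hi, i.1.2⟩
  · rintro ⟨hk, hk0⟩; exact ⟨(⟨k, hk0⟩, 0), hk, rfl⟩

/-- **BRIDGE: the Cartesian pairing with the Leray-projected first-order symbol IS the Craya-matrix
pairing of the coordinates.** For transversal mean-free families `f`, `g` with `f` supported in a
finite frequency set `Q`:
`∑_{k ∈ Q} ⟪f k, Π_k X g(k)⟫ = ∑_{p over Q} conj(crayaCoord f p) ∑_{q ∈ band(p)} A_pq crayaCoord g q`
(`X = AbcClassII.crossForm A B C`, `A = abcCrayaMatrix A B C`; the Leray multiplier is invisible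
against the transversal `f`, `AbcLatticeTailCoercivity.inner_lerayCoeff_eq`). -/
theorem sum_inner_leray_crossForm_eq_craya (A B C : ℝ) (f g : (Fin 3 → ℤ) → EuclideanSpace ℂ (Fin 3))
    (hft : ∀ k : Fin 3 → ℤ, ∑ j, ((k j : ℤ) : ℂ) * f k j = 0) (hf0 : f 0 = 0)
    (hgt : ∀ k : Fin 3 → ℤ, ∑ j, ((k j : ℤ) : ℂ) * g k j = 0) (hg0 : g 0 = 0)
    (Q : Finset (Fin 3 → ℤ)) (hfQ : ∀ k ∉ Q, f k = 0) :
    ∑ k ∈ Q, ⟪f k, Torus.lerayCoeff k (AbcClassII.crossForm A B C g k)⟫_ℂ =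
      ∑ p ∈ (Q.subtype fun k => k ≠ 0) ×ˢ (Finset.univ : Finset (Fin 2)),
        conj (crayaCoord f p) * ∑ q ∈ crayaNbr p, abcCrayaMatrix A B C p q * crayaCoord g q := by
  classical
  rw [sum_conj_mul_abcCrayaMatrix_eq₂ A B C (crayaCoord f) (crayaCoord g) _
    (fun p hp => crayaCoord_eq_zero_of_not_mem hfQ hp), image_fst_indices_over,
    crayaSynth_crayaCoord hft hf0, crayaSynth_crayaCoord hgt hg0, Finset.sum_filter]
  refine Finset.sum_congr rfl fun k _ => ?_
  by_cases hk : k = 0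
  · subst hk; rw [if_neg (not_not.mpr rfl), hf0, inner_zero_left]
  · rw [if_pos hk, AbcLatticeTailCoercivity.inner_lerayCoeff_eq f hf0 hft]

/-- instab4's basis families vanish at the origin (they live on orbits of non-zero frequencies). -/
theorem bfam_zero (i : AbcClassII.Idx) : AbcClassII.bfam i 0 = 0 := by
  obtain ⟨k, hk, hO⟩ := i.1.2
  refine AbcClassII.bfam_apply_of_not_mem i ?_
  rw [← hO]
  exact AbcClassII.zero_not_mem_sgnOrbit hk

/-- **Implementation 2's class-II matrix IS implementation 1's Craya compression of the same basis.**
For instab4's orbit-adapted basis families `bfam` (`AbcClassIIDefs`):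
`amat i j = Re ∑_{p over O_i} conj(crayaCoord (bfam i) p) ∑_{q ∈ band(p)} A_pq crayaCoord (bfam j) q`,
`A = abcCrayaMatrix 1 1 1` — one real matrix, two coordinate systems (TRIGGER-CENSUS T6 r50 «Craya ↔
Cartesian change of coordinates of the certificate matrices»). MODEL statement; not NS. -/
theorem amat_eq_re_craya (i j : AbcClassII.Idx) :
    AbcClassII.amat i j = (∑ p ∈ (i.1.1.subtype fun k => k ≠ 0) ×ˢ (Finset.univ : Finset (Fin 2)),
      conj (crayaCoord (AbcClassII.bfam i) p) *
        ∑ q ∈ crayaNbr p, abcCrayaMatrix 1 1 1 p q * crayaCoord (AbcClassII.bfam j) q).re := by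
  rw [AbcClassII.amat, sum_inner_leray_crossForm_eq_craya 1 1 1 _ _ (AbcClassII.bfam_spec i).1
    (bfam_zero i) (AbcClassII.bfam_spec j).1 (bfam_zero j) _
    (fun k hk => AbcClassII.bfam_apply_of_not_mem i hk)]

/-- **… and it is the (real) Craya compression itself**: the complex Craya pairing of two basis
families equals `amat i j` (no real part needed — reality §16 with the conjugate symmetry of `bfam`). -/
theorem craya_compression_bfam_eq_amat (i j : AbcClassII.Idx) :
    ∑ p ∈ (i.1.1.subtype fun k => k ≠ 0) ×ˢ (Finset.univ : Finset (Fin 2)),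
      conj (crayaCoord (AbcClassII.bfam i) p) *
        ∑ q ∈ crayaNbr p, abcCrayaMatrix 1 1 1 p q * crayaCoord (AbcClassII.bfam j) q =
      (AbcClassII.amat i j : ℂ) := by
  have hJ : ∀ l : AbcClassII.Idx, IsConjSymm (crayaSynth (crayaCoord (AbcClassII.bfam l))) := fun l => by
    rw [crayaSynth_crayaCoord (AbcClassII.bfam_spec l).1 (bfam_zero l)]
    exact (AbcClassII.bfam_spec l).2.2
  rw [amat_eq_re_craya,
    ← sum_conj_mul_abcCrayaMatrix_eq_ofReal_re 1 1 1 _ _ _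
      (fun p hp => crayaCoord_eq_zero_of_not_mem (fun k hk => AbcClassII.bfam_apply_of_not_mem i hk) hp)
      (hJ i) (hJ j)]

end Summit.NavierStokesRegularity.FluidComputer.AbcCrayaClassIIBridge

end
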